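/-
Copyright (c) 2026. All rights reserved.
Released under Apache 2.0 license as described in the file LICENSE.
Authors: HodgeCM publication cell (pub-hodgecm), GR lane, third hand (`pub-hodgecm-own-crow`).
-/
import Literature.NumberTheory.GelbartRogawski1991.Prop311PrintedCML2
import Literature.NumberTheory.GelbartRogawski1991.Prop311RhoPsiL2Frame
import Literature.NumberTheory.Weil1964.AdelicMetaplecticUnitaryLegAlongHom
import HarnessLib

-- buildfix G11b-3 recipe (LEDGER B13-1/B13-3): elaborate sequentially (dependent telescopes of the CM dual-pair datum).
set_option Elab.async false

/-!
# [GelbartRogawski1991, Prop. 3.1.1] AS PRINTED at CM data for the `L²(𝐀ⁿ)` model — every signature, no analytic binder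

Topic `NumberTheory/GelbartRogawski1991`; namespace `Literature.NumberTheory.GelbartRogawski1991.Prop311`.  KERNEL ONLY:
theorems; no definition, no named fact, no instance attribute, nothing of [GelbartRogawski1991] or [Weil1964] asserted;
`Prop311AsPrinted` is untouched (its BODY is proved, at CM data, for the model `cmL2Model` of `Prop311PrintedCML2`).

`Prop311PrintedCML2.prop311_CM_L2` (GR-2 lane) proves the body of the printed Prop. 3.1.1 for the `L²(𝐀_Fⁿ, ν)` model
`cmL2Model` from four inputs: `hd` (density of `𝒮` in `L²`), `hall` (scaled isometries), `hρi` (irreducibility of the model)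
and `hrank` — at every real place all but one of the `σ_v(-2 d fᵢ)` of one strict sign, i.e. `V` of real rank `≤ 1`
everywhere: the coverage of the archimedean `KAK` implementer sections through which Weil's majorant [Weil1964, n° 41
Lemme 5] gives the `L²`-continuity of `g ↦ [ω(s g)Φ]` along the compatible splitting `s`.

This file removes `hd`, `hall` and `hrank`:
* `hd`, `hall` are the discharged inputs `Weil1964.denseRange_schwartzBruhatToL2`,
  `Weil1964.adelicMpCont.toOp_mem_scaledIsometries_schwartzBruhatToL2` (`AdelicMetaplecticUnitaryLegAlongHom` §1);
* the strong continuity of the unitary leg along `relabel ∘ s` is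
  `Weil1964.adelicMpCont.continuous_toOp_unitaryLegL2_comp_adelicPairHom` — Riesz / Brezis–Lieb + Steinhaus–Weil automatic
  continuity on the second-countable locally compact group `U(J_V ⊗ J_W)(𝐀_F)` (`AdelicMetaplecticUnitaryLegContinuity`,
  `UnitaryGroupOfFormAdelicTopology`), valid for EVERY continuous homomorphism, hence for every signature of `V`.

* **`prop311_CM_L2_of_irreducible`** — for `L` CM, `(V, Φ)` skew-Hermitian with a `Φ`-orthogonal basis `b`,
  `Φ(bᵢ, bᵢ) = fᵢ δ_L` (ANY non-zero real `fᵢ`, any signs), `φ = Tr Φ` non-degenerate, `ν` any Haar measure on `𝐀_Fⁿ`: if the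
  model `cmL2Model` is irreducible (the binder `_hρi` of `Prop311AsPrinted`), then "`π` splits uniquely over `Sp_F(W)`" and
  clauses (1) ∧ (2) of Prop. 3.1.1 hold verbatim for it (`prop311_CM_L2` of `Prop311PrintedCML2` is the case `hrank`);
* **`prop311_CM_L2'`** — the same with `hρi` DISCHARGED by the GR-1 lane's `Prop311RhoPsiL2Frame`
  (`irreducible_rep_comp_toCoordHeisenberg`: the frame model is irreducible for every global character, here `ψ_F`):
  the body of `Prop311AsPrinted` at CM data for the `L²(𝐀_Fⁿ)` model with NO binder left beyond the printed data
  (`L, V, Φ, b, f, e`), the Haar measure `ν` and the two continuity witnesses `hψc`, `hβc` of the model's definition.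

Chain: `compatibleSplitting_pairLineDatum_CM` (stage-1 kernel `GRConstruction.gru_shape`: a continuous compatible `s` on
`U(T ⊗ 1 ⊗ₖ 1)(𝐀_F)`) → `adelicMpContRelabel` (to the standard Gram matrix) →
`adelicMpCont.continuous_toOp_unitaryLegL2_comp_adelicPairHom` (strong continuity of `adelicMpCont.unitaryLegL2` along
`relabel ∘ s`) → `legOfFrame` / `continuous_legOfFrame_comp` (print's `Mp_𝐀(W)` along the Darboux frame) →
`exists_isRationalSplitting_printed_conclusion_CM_of_darbouxLeg_along` (the along-the-section socket).

## References
* [GelbartRogawski1991] S. Gelbart, J. Rogawski, Invent. Math. 105 (1991) 445–472, §3.1 p. 454 L17–42, Prop. 3.1.1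
  p. 455 L1–2.
* [Weil1964] A. Weil, Acta Math. 111 (1964) 143–211, Chap. I n° 11–13, Chap. III n° 37–39.
* [HewittRoss1979] E. Hewitt, K. A. Ross, *Abstract Harmonic Analysis I*, 2nd ed. (1979), Thm. 22.18.
-/

set_option autoImplicit false

noncomputable section

open NumberField MeasureTheory
open scoped TensorProduct Matrix Kronecker
open Literature.NumberTheory.Automorphic
open Literature.RepresentationTheory.HeisenbergGroup
open Literature.RepresentationTheory.Unitary
open Literature.NumberTheory.Weil1964

namespace Literature.NumberTheory.GelbartRogawski1991

namespace Prop311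

open UnitaryDualPair

section CM

variable (L : Type) [Field L] [NumberField L] [IsCMField L]
variable {n : ℕ} (f : Fin n → ↥(maximalRealSubfield L))
variable (e : Fin n × Fin 1 ≃ Fin n) (he : ∀ k : Fin n, (e.symm k).1 = k)
-- `V` an `L`-space; its `L⁺`-structure is Mathlib's restriction (no separate binder).
variable (V : Type) [AddCommGroup V] [Module L V]
variable (b : Module.Basis (Fin n) L V) (Φ : V →ₗ[↥(maximalRealSubfield L)] V →ₗ[↥(maximalRealSubfield L)] L)
variable (hΦ₁ : ∀ (a : L) (x y : V), Φ (a • x) y = a * Φ x y)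
  (hΦ₂ : ∀ (a : L) (x y : V), Φ x (a • y) = Φ x y * IsCMField.complexConj L a)
  (hb : ∀ i j, i ≠ j → Φ (b i) (b j) = 0)
  (hf : ∀ i, Φ (b i) (b i) = algebraMap (↥(maximalRealSubfield L)) L (f i) * imagUnit L)
  (hφ : (traceForm (↥(maximalRealSubfield L)) L V Φ).Nondegenerate)
variable [MeasurableSpace (AdeleRing (𝓞 ↥(maximalRealSubfield L)) ↥(maximalRealSubfield L))]
  [BorelSpace (AdeleRing (𝓞 ↥(maximalRealSubfield L)) ↥(maximalRealSubfield L))]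
  (ν : Measure (Fin n → AdeleRing (𝓞 ↥(maximalRealSubfield L)) ↥(maximalRealSubfield L))) [ν.IsAddHaarMeasure]
  (hψc : Continuous (adeleAddChar ↥(maximalRealSubfield L) :
    AdeleRing (𝓞 ↥(maximalRealSubfield L)) ↥(maximalRealSubfield L) → Circle))
  (hβc : ∀ y : Fin n → AdeleRing (𝓞 ↥(maximalRealSubfield L)) ↥(maximalRealSubfield L),
    Continuous fun u : Fin n → AdeleRing (𝓞 ↥(maximalRealSubfield L)) ↥(maximalRealSubfield L) =>
      adelicForm (↥(maximalRealSubfield L)) (Fin n)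
        (1 : Matrix (Fin n) (Fin n) (AdeleRing (𝓞 ↥(maximalRealSubfield L)) ↥(maximalRealSubfield L))) u y)

include he in
/-- **[GelbartRogawski1991, Prop. 3.1.1] AS PRINTED AT CM DATA FOR THE `L²(𝐀_Fⁿ)` MODEL — EVERY SIGNATURE.**  `L` a CM field
(`F = L⁺`, `E = L`, `σ` = complex conjugation, `ψ = ψ_F`), `(V, Φ)` skew-Hermitian with a `Φ`-orthogonal basis `b`,
`Φ(bᵢ, bᵢ) = fᵢ δ_L`, `φ = Tr Φ` non-degenerate, `ρ = cmL2Model` on `L²(𝐀_Fⁿ, ν)`.  ONE input: `hρi`, the irreducibility of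
the model (the binder `_hρi` of `Prop311AsPrinted`).  Conclusion: THE rational splitting `i` of `π` over `Sp_F(W)` (exists,
unique) and clauses (1) ∧ (2) of Prop. 3.1.1 verbatim for this model.  Compared with `prop311_CM_L2`: no `hd`, no `hall`
(discharged: `denseRange_schwartzBruhatToL2`, `adelicMpCont.toOp_mem_scaledIsometries_schwartzBruhatToL2`) and NO `hrank`
(the operator continuity along the splitting is `adelicMpCont.continuous_toOp_unitaryLegL2_comp_adelicPairHom`:
Steinhaus–Weil on the locally compact second-countable `U(T ⊗ 1 ⊗ₖ 1)(𝐀_F)`, any signature).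
[cite: GelbartRogawski1991, §3.1 p. 454 L17–42; Prop. 3.1.1 p. 455 L1–2; Weil1964, Chap. I n° 13, Chap. III n° 37–39]
[cite: HewittRoss1979, Thm. 22.18] -/
theorem prop311_CM_L2_of_irreducible (hΦ₃ : ∀ x y : V, Φ y x = -IsCMField.complexConj L (Φ x y))
    (hρi : ∀ K : Submodule ℂ (Lp ℂ 2 ν), IsClosed (K : Set (Lp ℂ 2 ν)) →
      (∀ (h : AdelicHeisenberg (↥(maximalRealSubfield L)) L V Φ), ∀ g ∈ K,
        cmL2Model L f e he V b Φ hΦ₁ hΦ₂ hb hf hφ ν hψc hβc h g ∈ K) → K = ⊥ ∨ K = ⊤) :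
    ∃ i : ratSp (↥(maximalRealSubfield L)) L V Φ →*
        adelicMp (↥(maximalRealSubfield L)) L V Φ (cmL2Model L f e he V b Φ hΦ₁ hΦ₂ hb hf hφ ν hψc hβc),
      IsRationalSplitting (↥(maximalRealSubfield L)) L V Φ _ i ∧
      (∀ i' : ratSp (↥(maximalRealSubfield L)) L V Φ →*
          adelicMp (↥(maximalRealSubfield L)) L V Φ (cmL2Model L f e he V b Φ hΦ₁ hΦ₂ hb hf hφ ν hψc hβc),
        IsRationalSplitting (↥(maximalRealSubfield L)) L V Φ _ i' → i' = i) ∧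
      (∃ s : adelicUnitary (↥(maximalRealSubfield L)) L V Φ →*
            adelicMp (↥(maximalRealSubfield L)) L V Φ (cmL2Model L f e he V b Φ hΦ₁ hΦ₂ hb hf hφ ν hψc hβc),
          ∀ g : adelicUnitary (↥(maximalRealSubfield L)) L V Φ,
            projEnd (↥(maximalRealSubfield L)) L V Φ _ (s g) =
              ((g : AdelicSpace (↥(maximalRealSubfield L)) V ≃ₗ[AdeleRing (𝓞 ↥(maximalRealSubfield L)) ↥(maximalRealSubfield L)]
                  AdelicSpace (↥(maximalRealSubfield L)) V) :
                AdelicSpace (↥(maximalRealSubfield L)) V →ₗ[AdeleRing (𝓞 ↥(maximalRealSubfield L)) ↥(maximalRealSubfield L)]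
                  AdelicSpace (↥(maximalRealSubfield L)) V)) ∧
        ∃ s : adelicUnitary (↥(maximalRealSubfield L)) L V Φ →*
            adelicMp (↥(maximalRealSubfield L)) L V Φ (cmL2Model L f e he V b Φ hΦ₁ hΦ₂ hb hf hφ ν hψc hβc),
          Continuous s ∧
          (∀ g : adelicUnitary (↥(maximalRealSubfield L)) L V Φ,
            projEnd (↥(maximalRealSubfield L)) L V Φ _ (s g) =
              ((g : AdelicSpace (↥(maximalRealSubfield L)) V ≃ₗ[AdeleRing (𝓞 ↥(maximalRealSubfield L)) ↥(maximalRealSubfield L)]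
                  AdelicSpace (↥(maximalRealSubfield L)) V) :
                AdelicSpace (↥(maximalRealSubfield L)) V →ₗ[AdeleRing (𝓞 ↥(maximalRealSubfield L)) ↥(maximalRealSubfield L)]
                  AdelicSpace (↥(maximalRealSubfield L)) V)) ∧
          ∀ g : adelicUnitary (↥(maximalRealSubfield L)) L V Φ,
            IsRationalPoint (↥(maximalRealSubfield L)) L V Φ
                (g : AdelicSpace (↥(maximalRealSubfield L)) V ≃ₗ[AdeleRing (𝓞 ↥(maximalRealSubfield L)) ↥(maximalRealSubfield L)]
                  AdelicSpace (↥(maximalRealSubfield L)) V) →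
              s g ∈ i.range := by
  haveI := secondCountableTopology_adeleRing (↥(maximalRealSubfield L))
  -- frame data (explicit terms; `have` before `rcases` under the large goal)
  have hT := isUnit_det_cmLineGram_of_nondegenerate L f V b Φ hΦ₁ hΦ₂ hb hf hφ
  have hf0 : ∀ i, f i ≠ 0 := frame_ne_zero_of_nondegenerate (↥(maximalRealSubfield L)) L (IsCMField.complexConj L) V b Φ f
    hΦ₁ hΦ₂ hb hf hφ
  have hT1 : IsUnit (1 : Matrix (Fin n) (Fin n) (AdeleRing (𝓞 ↥(maximalRealSubfield L)) ↥(maximalRealSubfield L))).det := by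
    rw [Matrix.det_one]; exact isUnit_one
  -- the two analytic inputs of the `L²` leg, discharged
  have hd : DenseRange (schwartzBruhatToL2 (↥(maximalRealSubfield L)) (Fin n) ν) := Weil1964.denseRange_schwartzBruhatToL2 ν
  have hall := adelicMpCont.toOp_mem_scaledIsometries_schwartzBruhatToL2
    (1 : Matrix (Fin n) (Fin n) (AdeleRing (𝓞 ↥(maximalRealSubfield L)) ↥(maximalRealSubfield L))) hT1 ν
  have hψb := adelicMpCont.continuous_toOp_unitaryLegL2 ν
    (1 : Matrix (Fin n) (Fin n) (AdeleRing (𝓞 ↥(maximalRealSubfield L)) ↥(maximalRealSubfield L))) hψc hβc hd hall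
  have hψ := adelicMpCont.proj_unitaryLegL2 ν
    (1 : Matrix (Fin n) (Fin n) (AdeleRing (𝓞 ↥(maximalRealSubfield L)) ↥(maximalRealSubfield L))) hψc hβc hd hall
  have hGR := compatibleSplitting_pairLineDatum_CM L f e hf0 hT
  rcases hGR with ⟨s, hsc, hs⟩
  -- the relabelled splitting `relabel ∘ s : U(T ⊗ 1 ⊗ₖ 1)(𝐀_F) →* Mp_ψ(W_𝐀)ᶜᵒⁿᵗ` (standard Gram matrix), continuous
  have hrc := continuous_adelicMpContRelabel (↥(maximalRealSubfield L)) (Fin n) (legGL (↥(maximalRealSubfield L)) f e hT)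
    (one_mul_legGL (↥(maximalRealSubfield L)) f e hT)
  have hs'c : Continuous ((adelicMpContRelabel (↥(maximalRealSubfield L)) (Fin n) (legGL (↥(maximalRealSubfield L)) f e hT)
      (one_mul_legGL (↥(maximalRealSubfield L)) f e hT)).toMonoidHom.comp s) := hrc.comp hsc
  -- continuity of the leg along `relabel ∘ s` (symplectic orbit maps: tautological; operators: Steinhaus–Weil in `L²`)
  have hcont := continuous_legOfFrame_comp
    (darbouxFrame (↥(maximalRealSubfield L)) L (IsCMField.complexConj L) (complexConj_imagUnit L) (imagUnit_ne_zero L)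
      (imagUnit_mul_self L) V b f e hT)
    (adelicTraceForm_darbouxFrame (↥(maximalRealSubfield L)) L (IsCMField.complexConj L) (complexConj_imagUnit L)
      (imagUnit_ne_zero L) (imagUnit_mul_self L) V b Φ f e he hT hΦ₁ hΦ₂ hb hf)
    (cmL2Model L f e he V b Φ hΦ₁ hΦ₂ hb hf hφ ν hψc hβc)
    (SchrodingerHaar.rep (adelicForm (↥(maximalRealSubfield L)) (Fin n)
      (1 : Matrix (Fin n) (Fin n) (AdeleRing (𝓞 ↥(maximalRealSubfield L)) ↥(maximalRealSubfield L))))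
      (adeleAddChar ↥(maximalRealSubfield L)) hψc hβc ν)
    (fun _ _ => rfl)
    (adelicMpCont.unitaryLegL2 ν
      (1 : Matrix (Fin n) (Fin n) (AdeleRing (𝓞 ↥(maximalRealSubfield L)) ↥(maximalRealSubfield L))) hψc hβc hd hall) hψb
    (fun g => adelicMpContRelabel (↥(maximalRealSubfield L)) (Fin n) (legGL (↥(maximalRealSubfield L)) f e hT)
      (one_mul_legGL (↥(maximalRealSubfield L)) f e hT) (s g))
    (fun c => (((adelicMpCont.continuous_proj_apply c).comp (hrc.comp hsc)).congr fun g =>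
      congrArg (fun q : symplecticGroup (polar (adelicForm (↥(maximalRealSubfield L)) (Fin n)
          (1 : Matrix (Fin n) (Fin n) (AdeleRing (𝓞 ↥(maximalRealSubfield L)) ↥(maximalRealSubfield L))))) =>
        ((q : ((Fin n → AdeleRing (𝓞 ↥(maximalRealSubfield L)) ↥(maximalRealSubfield L)) ×
            (Fin n → AdeleRing (𝓞 ↥(maximalRealSubfield L)) ↥(maximalRealSubfield L))) ≃ₗ[
            AdeleRing (𝓞 ↥(maximalRealSubfield L)) ↥(maximalRealSubfield L)]
          ((Fin n → AdeleRing (𝓞 ↥(maximalRealSubfield L)) ↥(maximalRealSubfield L)) ×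
            (Fin n → AdeleRing (𝓞 ↥(maximalRealSubfield L)) ↥(maximalRealSubfield L)))) c))
        (hψ _).symm))
    (fun g' => adelicMpCont.continuous_toOp_unitaryLegL2_comp_adelicPairHom (↥(maximalRealSubfield L))
      (1 : Matrix (Fin n) (Fin n) (AdeleRing (𝓞 ↥(maximalRealSubfield L)) ↥(maximalRealSubfield L))) hT1 ν hψc hβc hd hall
      (IsCMField.complexConj L) n 1 _ _ _ hs'c g')
  exact exists_isRationalSplitting_printed_conclusion_CM_of_darbouxLeg_along L f e he V b Φ
    (cmL2Model L f e he V b Φ hΦ₁ hΦ₂ hb hf hφ ν hψc hβc) hΦ₁ hΦ₂ hΦ₃ hb hf hφ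
    (norm_cmL2Model L f e he V b Φ hΦ₁ hΦ₂ hb hf hφ ν hψc hβc) hρi _
    (proj_legOfFrame_frame _ _ _ _ (fun _ _ => rfl) _ hψb hψ) ⟨s, hs, hcont⟩

include he in
/-- **[GelbartRogawski1991, Prop. 3.1.1] AS PRINTED AT CM DATA FOR THE `L²(𝐀_Fⁿ)` MODEL — NO BINDER LEFT.**  As
`prop311_CM_L2_of_irreducible`, with the irreducibility of `cmL2Model` supplied by the GR-1 lane's
`irreducible_rep_comp_toCoordHeisenberg` (`Prop311RhoPsiL2Frame`; `ψ_F` is a global character,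
`isGlobalAddChar_adeleAddChar`): for EVERY CM field `L`, every skew-Hermitian `(V, Φ)` with a `Φ`-orthogonal basis (any
signature at every real place), every line enumeration `e` and every Haar measure `ν`, THE rational splitting `i` of `π` over
`Sp_F(W)` exists uniquely and clauses (1) ∧ (2) of Prop. 3.1.1 hold verbatim for `ρ = cmL2Model`.
[cite: GelbartRogawski1991, §3.1 p. 454 L17–42; Prop. 3.1.1 p. 455 L1–2; Weil1964, Chap. I n° 11–13, Chap. III n° 37–39]
[cite: HewittRoss1979, Thm. 22.18] -/
theorem prop311_CM_L2' (hΦ₃ : ∀ x y : V, Φ y x = -IsCMField.complexConj L (Φ x y)) :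
    ∃ i : ratSp (↥(maximalRealSubfield L)) L V Φ →*
        adelicMp (↥(maximalRealSubfield L)) L V Φ (cmL2Model L f e he V b Φ hΦ₁ hΦ₂ hb hf hφ ν hψc hβc),
      IsRationalSplitting (↥(maximalRealSubfield L)) L V Φ _ i ∧
      (∀ i' : ratSp (↥(maximalRealSubfield L)) L V Φ →*
          adelicMp (↥(maximalRealSubfield L)) L V Φ (cmL2Model L f e he V b Φ hΦ₁ hΦ₂ hb hf hφ ν hψc hβc),
        IsRationalSplitting (↥(maximalRealSubfield L)) L V Φ _ i' → i' = i) ∧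
      (∃ s : adelicUnitary (↥(maximalRealSubfield L)) L V Φ →*
            adelicMp (↥(maximalRealSubfield L)) L V Φ (cmL2Model L f e he V b Φ hΦ₁ hΦ₂ hb hf hφ ν hψc hβc),
          ∀ g : adelicUnitary (↥(maximalRealSubfield L)) L V Φ,
            projEnd (↥(maximalRealSubfield L)) L V Φ _ (s g) =
              ((g : AdelicSpace (↥(maximalRealSubfield L)) V ≃ₗ[AdeleRing (𝓞 ↥(maximalRealSubfield L)) ↥(maximalRealSubfield L)]
                  AdelicSpace (↥(maximalRealSubfield L)) V) :
                AdelicSpace (↥(maximalRealSubfield L)) V →ₗ[AdeleRing (𝓞 ↥(maximalRealSubfield L)) ↥(maximalRealSubfield L)]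
                  AdelicSpace (↥(maximalRealSubfield L)) V)) ∧
        ∃ s : adelicUnitary (↥(maximalRealSubfield L)) L V Φ →*
            adelicMp (↥(maximalRealSubfield L)) L V Φ (cmL2Model L f e he V b Φ hΦ₁ hΦ₂ hb hf hφ ν hψc hβc),
          Continuous s ∧
          (∀ g : adelicUnitary (↥(maximalRealSubfield L)) L V Φ,
            projEnd (↥(maximalRealSubfield L)) L V Φ _ (s g) =
              ((g : AdelicSpace (↥(maximalRealSubfield L)) V ≃ₗ[AdeleRing (𝓞 ↥(maximalRealSubfield L)) ↥(maximalRealSubfield L)]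
                  AdelicSpace (↥(maximalRealSubfield L)) V) :
                AdelicSpace (↥(maximalRealSubfield L)) V →ₗ[AdeleRing (𝓞 ↥(maximalRealSubfield L)) ↥(maximalRealSubfield L)]
                  AdelicSpace (↥(maximalRealSubfield L)) V)) ∧
          ∀ g : adelicUnitary (↥(maximalRealSubfield L)) L V Φ,
            IsRationalPoint (↥(maximalRealSubfield L)) L V Φ
                (g : AdelicSpace (↥(maximalRealSubfield L)) V ≃ₗ[AdeleRing (𝓞 ↥(maximalRealSubfield L)) ↥(maximalRealSubfield L)]
                  AdelicSpace (↥(maximalRealSubfield L)) V) →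
              s g ∈ i.range :=
  prop311_CM_L2_of_irreducible L f e he V b Φ hΦ₁ hΦ₂ hb hf hφ ν hψc hβc hΦ₃ fun K hKc hK =>
    irreducible_rep_comp_toCoordHeisenberg
      (darbouxFrame (↥(maximalRealSubfield L)) L (IsCMField.complexConj L) (complexConj_imagUnit L) (imagUnit_ne_zero L)
        (imagUnit_mul_self L) V b f e (isUnit_det_cmLineGram_of_nondegenerate L f V b Φ hΦ₁ hΦ₂ hb hf hφ))
      (adelicTraceForm_darbouxFrame (↥(maximalRealSubfield L)) L (IsCMField.complexConj L) (complexConj_imagUnit L)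
        (imagUnit_ne_zero L) (imagUnit_mul_self L) V b Φ f e he
        (isUnit_det_cmLineGram_of_nondegenerate L f V b Φ hΦ₁ hΦ₂ hb hf hφ) hΦ₁ hΦ₂ hb hf)
      (adeleAddChar ↥(maximalRealSubfield L)) hψc hβc ν (isGlobalAddChar_adeleAddChar _) K hKc hK

end CM

end Prop311

end Literature.NumberTheory.GelbartRogawski1991

end
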